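import Literature.MathematicalPhysics.QuantumFieldTheory.Balaban1983to89.T4ShellMeasureDet
import Literature.MathematicalPhysics.QuantumFieldTheory.Balaban1983to89.T4DressedR

/-!
# N21 (NE7c), strategy s3 «alternative currency», file 20r — THE (1.100) TERM LAW ON THE LOCAL DILATION ROAD (LENS nearmiss g13 ROW J = §J3 + §J5,
# landed verbatim with credit): (M1) for one (1.100) term `num · Fx` from the chart data (CH) on the block and per-ray fibre alternatives asked of the
# BLOCK-READING part only — block-blind inserts `Fx` (`IndepOf s`) are ray-constants and cost NOTHING in the (DC-loc) budget; and block-READING inserts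
# that are fibre integrals over OTHER variables (the (1.100) denominators) INHERIT two-sided ∕ forward log-Lipschitz control along the ray

PROVENANCE AND CREDIT.  This module is the planner seat `ym-lens-BalabanUVNodes-nearmiss`'s `Sketch-nearmiss-g13.lean` §J3 + §J5 (sha16 2359723bfc884d48; memo
`LENS-nearmiss.md` v13.0∕v14.0 ROW J «20r `…N21Term1100LocalDilation` = Sketch-g13 §J3 + §J5 verbatim, 7 thm, imports `T4ShellMeasureDet` + `T4DressedR` only —
UN-OWNED … first refusal n21-e, whose 20p it extends», bus l.18911 ∕ l.19323) landed VERBATIM by seat `pub-ymgap-dag-n21-e` (g9; TAKE-J l.19373); the filer's only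
changes: this header and the namespace.  Companion of file 24 `…N21InsertFibreShell` (ROW M + §J1–§J2′ junction).  Lane: `--kind proof --supports stmt-QuantumFields-20296
--as helper` (K3⁵ `SpineGivenEndpointR13SepCoP`).  Count-neutral.

THE CONTENT (lens §J3 ∕ §J5).
§J3 ★ (M1) FOR ONE (1.100) TERM FROM THE LOCAL DILATION ON THE BLOCK, BLOCK-BLIND INSERTS EXCLUDED FROM THE BUDGET.  Data exactly as pub-balaban's
    `T4ShellMeasureDet.slotAntiConcentration_realized_local` (bonds `s` of the block, per exterior a chart (CH) `(blockLaw s).withDensity (w V) = (μE.withDensity (J V)).map (κ V)`,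
    tested variable `u`, window `(δ, sOn, B, θ, ρ, ℓ₀, L)`), but the realized density is a (1.100) TERM `num · Fx`: `num` reads the block (fibre sections
    `w V · r V`), `Fx` is everything else (`IndepOf s Fx`: ratios of earlier operations whose regions miss `s`, the old operation, the slot-free dressing).  The
    per-ray alternatives are asked of `J V · (r V ∘ κ V)` ONLY; `Fx` is a ray-constant absorbed by `fibreAlternative_polarDensity_mul` with a constant co-factor.
    Conclusion: (M1) for `(fieldMeasure P j G).withDensity (num · Fx)` with `D = 2·fibreCoef δ B ℓ₀ L` (`slotAntiConcentration_term1100_of_localDilation`); the same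
    with KEPT non-decreasing co-tests `χ` (`…_kept`).
§J5 ★ LOG-LIPSCHITZ IS INHERITED BY INTEGRALS: if every frozen-variable section `t ↦ f t z` is two-sided (forward) log-Lipschitz with constant `B` on `W`, so is
    `t ↦ ∫⁻ z, f t z ∂ν` (`logLipschitzOn_lintegral` ∕ `fwdLogLipschitzOn_lintegral`); a positive real ray-function with two-sided control has its `ofReal`-INVERSE
    two-sided with the same constant (`toReal_le_of_logLipschitzOn`, `logLipschitzOn_ofReal_inv`); hence the normalised (1.100) term `num·den⁻¹` read along a block ray
    is forward log-Lipschitz with the SUM of the constants (`fwdLogLipschitzOn_normTerm_ray`, `FwdLogLipschitzOn.mul` BY NAME): the (1.100) denominators enter the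
    (DC-loc) budget ADDITIVELY.  (Lens kill-test, displayed: a plaquette with bonds in both `s` and `Λ_l` makes `num_l`'s window switch along the ray for some
    frozen `z` — the pointwise hypothesis then fails; only an averaged (DC) could survive.)

HONEST FRAMING.  NE7c is NOT PRINTED and NOT PROVED.  [folklore] real analysis ∕ measure bookkeeping over pub-balaban's `T4ShellMeasure*` chain; (CH), the window
factorisation, the per-ray alternatives and the per-`z` log-Lipschitz control are HYPOTHESIS SHAPES = exactly the unprinted estimates; nothing of Bałaban's asserted;
N21 NOT discharged; counts UNMOVED; count-neutral; one finite 𝕋⁴ at fixed `ε`; NOT ℝ⁴ ∕ OS ∕ mass gap ∕ Clay.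

CITATION HEADER (lean-in-tree rule 2026-08-18).  BY NAME: `T4ShellMeasureDet.slotAntiConcentration_realized_local` ∕ `blockLaw` ∕ `measurable_section`;
`T4ShellMeasurePolar.polarDensity` ∕ `polarDensity_of_norm_eq_one` ∕ `fibreAlternative_polarDensity_mul` ∕ `dilate`; `T4ShellMeasureAnalytic.FibreAlternative` ∕
`fibreAlternative_congr` ∕ `FwdLogLipschitzOn` ∕ `FwdLogLipschitzOn.mul` ∕ `.of_logLipschitzOn`; `T4ShellMeasureFibre.LogLipschitzOn` ∕ `fibreCoef`; `B15.BasicStep.IndepOf`.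
Context only (SHAPE, nothing asserted): [Balaban1989LargeFieldI] (1.100) p. 198 (the term shape `num · den⁻¹ · …`).

WHAT IS PROVED ([folklore]; lens g13 §J3 ∕ §J5; 7 theorems, 0 `def`).  §J3 ★ `slotAntiConcentration_term1100_of_localDilation` · `slotAntiConcentration_term1100_of_localDilation_kept`;
§J5 ★ `logLipschitzOn_lintegral` · `fwdLogLipschitzOn_lintegral` · `toReal_le_of_logLipschitzOn` · `logLipschitzOn_ofReal_inv` · ★ `fwdLogLipschitzOn_normTerm_ray`.
-/

set_option autoImplicit false

noncomputable section

open MeasureTheory Set Function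
open scoped ENNReal NNReal

namespace Summit.QuantumFields.YangMills.Theorems.N21Term1100LocalDilation

open Literature.MathematicalPhysics.QuantumFieldTheory.Balaban1983to89
open T4ShellMeasure T4ShellMeasureFibre T4ShellMeasureAnalytic T4ShellMeasurePolar T4ShellMeasureLocal
  T4ShellMeasureDet
open B15.BasicStep (fibreIntegral IndepOf lmarginal_mul_of_indepOf)
open T4DressedR (FibreIndep)

section Junction

variable {P : Params} {j : ℕ} {G : Type*} [GaugeGroup G] [MeasurableSpace G] [HaarData G]
  [DecidableEq (PBond P j)]

/-! ## §J3 ★ the (1.100) term law on the dilation road: inserts that do not read the block are FREE -/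

variable {E : Type*} [NormedAddCommGroup E] [NormedSpace ℝ E] [MeasurableSpace E] [BorelSpace E]
  [FiniteDimensional ℝ E] [Nontrivial E] (μE : Measure E) [μE.IsAddHaarMeasure]

/-- §J3 ★ **(M1) FOR ONE (1.100) TERM FROM THE LOCAL DILATION ON THE BLOCK, BLOCK-BLIND INSERTS EXCLUDED FROM THE
BUDGET.**  Data exactly as `T4ShellMeasureDet.slotAntiConcentration_realized_local` (bonds `s` of the block, per
exterior a chart (CH) `(blockLaw s).withDensity (w V) = (μE.withDensity (J V)).map (κ V)`, the tested variable `u`,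
window `(δ, sOn, B, θ, ρ, ℓ₀, L)`), but the realized density is a (1.100) TERM `num · Fx`: `num` = the part that
reads the block (fibre sections `w V · r V`: window × rest), `Fx` = everything else of the term (`IndepOf s Fx`:
ratios of earlier operations whose regions miss `s`, the old operation, the slot-free dressing).  The per-ray
alternatives are asked of `J V · (r V ∘ κ V)` ONLY — `Fx` never enters them: along every ray it is the constant
`Fx V`, absorbed by `fibreAlternative_polarDensity_mul` with a constant (hence monotone) co-factor.  Conclusion: (M1)
for `(fieldMeasure P j G).withDensity (num · Fx)` with `D = 2·fibreCoef δ B ℓ₀ L`, `B` the (DC-loc) constant of the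
block-reading part alone. [folklore] -/
theorem slotAntiConcentration_term1100_of_localDilation (s : Finset (PBond P j))
    {κ : GaugeField P j G → E → (↥s → G)} (hκ : ∀ V, Measurable (κ V))
    {J : GaugeField P j G → E → ℝ≥0∞} (hJ : ∀ V, Measurable (J V))
    {w r : GaugeField P j G → (↥s → G) → ℝ≥0∞} (hw : ∀ V, Measurable (w V)) (hr : ∀ V, Measurable (r V))
    (hchart : ∀ V, (blockLaw s).withDensity (w V) = (μE.withDensity (J V)).map (κ V))
    {num Fx : GaugeField P j G → ℝ≥0∞} (hnum : Measurable num) (hFx : Measurable Fx) (hind : IndepOf s Fx)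
    (hnumw : ∀ V y, num (updateFinset V s y) = w V y * r V y)
    {u : GaugeField P j G → ℝ} (hu : Measurable u)
    {δ sOn B θ ρ ℓ₀ L : ℝ} (hδ0 : 0 ≤ δ) (hδ1 : δ < 1) (hB : 0 ≤ B) (hθ : 0 < θ) (hθs : θ ≤ sOn) (hρ0 : 0 ≤ ρ)
    (hρ2 : ρ ≤ 1 / 2) (hℓ₀ : -Real.log (1 - ρ) ≤ ℓ₀) (hlam : 0 < L / (1 + δ) - ℓ₀ / (1 - δ))
    (hfib : ∀ V, ∀ y : E, ‖y‖ = 1 →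
      FibreAlternative (polarDensity (Module.finrank ℝ E) fun x => J V x * r V (κ V x))
        (((fun y => u (updateFinset V s y)) ∘ κ V) ∘ dilate) δ sOn B θ ρ L y) :
    SlotAntiConcentration ((fieldMeasure P j G).withDensity fun U => num U * Fx U) u θ ρ
      (2 * fibreCoef δ B ℓ₀ L) := by
  refine slotAntiConcentration_realized_local s μE hκ hJ hw (R := fun V y => r V y * Fx V)
    (fun V => (hr V).mul_const _) hchart (F := fun U => num U * Fx U) (hnum.mul hFx)
    (fun V y => show num _ * Fx _ = _ by rw [hnumw V y, hind V y, mul_assoc]) hu hδ0 hδ1 hB hθ hθs hρ0 hρ2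
    hℓ₀ hlam fun V y hy => ?_
  exact fibreAlternative_congr (fun ρ' => by simp only [polarDensity_of_norm_eq_one hy, mul_assoc])
    (fibreAlternative_polarDensity_mul (χ := fun _ : E => Fx V) hy (hfib V y hy) monotone_const)

/-- §J3′ the same with the KEPT co-tests `χ` (non-decreasing along every ray, `slot_field_realized_placed`'s `hmono`)
riding inside the density next to the block-blind inserts: (M1) for `fieldMeasure.withDensity (num · Fx · χ)`, same
constant. [folklore] -/
theorem slotAntiConcentration_term1100_of_localDilation_kept (s : Finset (PBond P j))
    {κ : GaugeField P j G → E → (↥s → G)} (hκ : ∀ V, Measurable (κ V))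
    {J : GaugeField P j G → E → ℝ≥0∞} (hJ : ∀ V, Measurable (J V))
    {w r : GaugeField P j G → (↥s → G) → ℝ≥0∞} (hw : ∀ V, Measurable (w V)) (hr : ∀ V, Measurable (r V))
    (hchart : ∀ V, (blockLaw s).withDensity (w V) = (μE.withDensity (J V)).map (κ V))
    {num Fx χ : GaugeField P j G → ℝ≥0∞} (hnum : Measurable num) (hFx : Measurable Fx) (hχ : Measurable χ)
    (hind : IndepOf s Fx) (hnumw : ∀ V y, num (updateFinset V s y) = w V y * r V y)
    {u : GaugeField P j G → ℝ} (hu : Measurable u)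
    {δ sOn B θ ρ ℓ₀ L : ℝ} (hδ0 : 0 ≤ δ) (hδ1 : δ < 1) (hB : 0 ≤ B) (hθ : 0 < θ) (hθs : θ ≤ sOn) (hρ0 : 0 ≤ ρ)
    (hρ2 : ρ ≤ 1 / 2) (hℓ₀ : -Real.log (1 - ρ) ≤ ℓ₀) (hlam : 0 < L / (1 + δ) - ℓ₀ / (1 - δ))
    (hfib : ∀ V, ∀ y : E, ‖y‖ = 1 →
      FibreAlternative (polarDensity (Module.finrank ℝ E) fun x => J V x * r V (κ V x))
        (((fun y => u (updateFinset V s y)) ∘ κ V) ∘ dilate) δ sOn B θ ρ L y)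
    (hmono : ∀ V, ∀ y : E, ‖y‖ = 1 → Monotone fun t : ℝ => χ (updateFinset V s (κ V (Real.exp (-t) • y)))) :
    SlotAntiConcentration ((fieldMeasure P j G).withDensity fun U => num U * Fx U * χ U) u θ ρ
      (2 * fibreCoef δ B ℓ₀ L) := by
  refine slotAntiConcentration_realized_local s μE hκ hJ hw
    (R := fun V y => r V y * Fx V * χ (updateFinset V s y))
    (fun V => ((hr V).mul_const _).mul (measurable_section s hχ V)) hchart
    (F := fun U => num U * Fx U * χ U) ((hnum.mul hFx).mul hχ)
    (fun V y => show num _ * Fx _ * χ _ = _ by rw [hnumw V y, hind V y, mul_assoc, mul_assoc, mul_assoc]) hu hδ0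
    hδ1 hB hθ hθs hρ0 hρ2 hℓ₀ hlam fun V y hy => ?_
  have h1 := fibreAlternative_polarDensity_mul (χ := fun _ : E => Fx V) hy (hfib V y hy) monotone_const
  have h2 := fibreAlternative_polarDensity_mul (χ := fun x : E => χ (updateFinset V s (κ V x))) hy h1 (hmono V y hy)
  exact fibreAlternative_congr (fun ρ' => by simp only [polarDensity_of_norm_eq_one hy, mul_assoc]) h2

end Junction

/-! ## §J5 ★ block-READING inserts that are fibre integrals inherit log-Lipschitz control along the ray -/

section Inherit

variable {Z : Type*} [MeasurableSpace Z] (ν : Measure Z)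

/-- §J5 ★ **LOG-LIPSCHITZ IS INHERITED BY INTEGRALS.**  If every frozen-variable section `t ↦ f t z` is two-sided
log-Lipschitz with constant `B` on `W`, so is `t ↦ ∫⁻ z, f t z ∂ν` (`lintegral_mono`, constant pulled out) — the
(1.100) denominators `den_l(U) = ∫⌈_{Λ_l} num_l` read along a block ray inherit (DC-loc) from `num_l`'s sections,
pointwise in the integrated variables `z`. [folklore] -/
theorem logLipschitzOn_lintegral {f : ℝ → Z → ℝ≥0∞} {B : ℝ} {W : Set ℝ}
    (h : ∀ z, LogLipschitzOn (fun t => f t z) B W) : LogLipschitzOn (fun t => ∫⁻ z, f t z ∂ν) B W := by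
  intro t ht t' ht'
  calc ∫⁻ z, f t z ∂ν ≤ ∫⁻ z, ENNReal.ofReal (Real.exp (B * |t - t'|)) * f t' z ∂ν :=
        lintegral_mono fun z => h z ht ht'
    _ = ENNReal.ofReal (Real.exp (B * |t - t'|)) * ∫⁻ z, f t' z ∂ν :=
        lintegral_const_mul' _ _ ENNReal.ofReal_ne_top

/-- §J5′ the forward (one-sided) version, same proof. [folklore] -/
theorem fwdLogLipschitzOn_lintegral {f : ℝ → Z → ℝ≥0∞} {B : ℝ} {W : Set ℝ}
    (h : ∀ z, FwdLogLipschitzOn (fun t => f t z) B W) : FwdLogLipschitzOn (fun t => ∫⁻ z, f t z ∂ν) B W := by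
  intro t ht t' ht' htt'
  calc ∫⁻ z, f t z ∂ν ≤ ∫⁻ z, ENNReal.ofReal (Real.exp (B * (t' - t))) * f t' z ∂ν :=
        lintegral_mono fun z => h z ht ht' htt'
    _ = ENNReal.ofReal (Real.exp (B * (t' - t))) * ∫⁻ z, f t' z ∂ν :=
        lintegral_const_mul' _ _ ENNReal.ofReal_ne_top

/-- §J5a the real reading of a finite log-Lipschitz `ℝ≥0∞`-function (for `den_l = (∫⁻ …).toReal`). [folklore] -/
theorem toReal_le_of_logLipschitzOn {F : ℝ → ℝ≥0∞} {B : ℝ} {W : Set ℝ} (h : LogLipschitzOn F B W)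
    (htop : ∀ t, F t ≠ ⊤) ⦃t : ℝ⦄ (ht : t ∈ W) ⦃t' : ℝ⦄ (ht' : t' ∈ W) :
    (F t).toReal ≤ Real.exp (B * |t - t'|) * (F t').toReal := by
  calc (F t).toReal ≤ (ENNReal.ofReal (Real.exp (B * |t - t'|)) * F t').toReal :=
        ENNReal.toReal_mono (ENNReal.mul_ne_top ENNReal.ofReal_ne_top (htop t')) (h ht ht')
    _ = Real.exp (B * |t - t'|) * (F t').toReal := by
        rw [ENNReal.toReal_mul, ENNReal.toReal_ofReal (Real.exp_pos _).le]

/-- §J5b the INVERSE of a positive real two-sided log-Lipschitz function is log-Lipschitz with the SAME constant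
(the (1.100) factor `den_l⁻¹`). [folklore] -/
theorem logLipschitzOn_ofReal_inv {d : ℝ → ℝ} {B : ℝ} {W : Set ℝ} (hd : ∀ t, 0 < d t)
    (h : ∀ ⦃t⦄, t ∈ W → ∀ ⦃t'⦄, t' ∈ W → d t ≤ Real.exp (B * |t - t'|) * d t') :
    LogLipschitzOn (fun t => ENNReal.ofReal ((d t)⁻¹)) B W := by
  intro t ht t' ht'
  have h' := h ht' ht
  rw [abs_sub_comm] at h'
  have key : (d t)⁻¹ ≤ Real.exp (B * |t - t'|) * (d t')⁻¹ := by
    rw [← div_eq_mul_inv, le_div_iff₀ (hd t'), inv_mul_le_iff₀ (hd t), mul_comm]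
    exact h'
  calc ENNReal.ofReal ((d t)⁻¹) ≤ ENNReal.ofReal (Real.exp (B * |t - t'|) * (d t')⁻¹) := ENNReal.ofReal_le_ofReal key
    _ = ENNReal.ofReal (Real.exp (B * |t - t'|)) * ENNReal.ofReal ((d t')⁻¹) :=
        ENNReal.ofReal_mul (Real.exp_pos _).le

/-- §J5c ★ **THE NORMALISED (1.100) TERM ALONG THE RAY.**  Numerator forward log-Lipschitz with `B₁` ((DC-loc) of the
block-reading part), denominator = a fibre integral whose integrand sections are two-sided log-Lipschitz with `B₂`
pointwise in the frozen variables and which is finite and positive ⇒ the ray density `num · den⁻¹` is forward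
log-Lipschitz with `B₁ + B₂` (`FwdLogLipschitzOn.mul`, `.of_logLipschitzOn` BY NAME): the denominators of (1.100)
enter the (DC-loc) budget ADDITIVELY, not as an obstruction. [folklore] -/
theorem fwdLogLipschitzOn_normTerm_ray {numR : ℝ → ℝ≥0∞} {f : ℝ → Z → ℝ≥0∞} {B₁ B₂ : ℝ} {W : Set ℝ}
    (hnum : FwdLogLipschitzOn numR B₁ W) (hf : ∀ z, LogLipschitzOn (fun t => f t z) B₂ W)
    (htop : ∀ t, ∫⁻ z, f t z ∂ν ≠ ⊤) (hpos : ∀ t, 0 < (∫⁻ z, f t z ∂ν).toReal) :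
    FwdLogLipschitzOn (fun t => numR t * ENNReal.ofReal (((∫⁻ z, f t z ∂ν).toReal)⁻¹)) (B₁ + B₂) W :=
  hnum.mul (FwdLogLipschitzOn.of_logLipschitzOn
    (logLipschitzOn_ofReal_inv hpos (toReal_le_of_logLipschitzOn (logLipschitzOn_lintegral ν hf) htop)))

end Inherit

end Summit.QuantumFields.YangMills.Theorems.N21Term1100LocalDilation
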